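/-
Copyright (c) 2026 the pub-hodgecm-mathlib formalisation cell (harness21).  Prover seat hodgecm-mathlib-K2E4-p11 (g9): Track B «K2-LIT»,
hLiu418 = stmt-HodgeConjecture-24832, socket #41 KIND W, organ «Φ6b-ind» FILE 2a (LEAD F0P6-plan (g14) BATCH #178 (1), KW desk F0P2-p08 (g3)):
THE LINE-DERIVATIVE CALCULUS OF SHIMURA's ξ-INTEGRAND ON `Herm₂(ℂ)` — slit plane, index shifts, first line derivatives in every chart direction
(the Cayley identities proper are FILE 2b `K2LiuHermTwoXiIntegrandCayley`).
THEOREMS ONLY (no `def`, no `instance`, no `notation`, no named-fact hypothesis, no `sorry`).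
-/
import Summits.HodgeConjecture.HodgeConjecture.Theorems.K2LiuHermTwoConfluentXiConvergence   -- ★ (K2E5-p16) `xiTwoIntegrand`, `det_sub_I_smul_eq_conj`, `norm_det_add_I_smul_pos`
import Summits.HodgeConjecture.HodgeConjecture.Theorems.K2LiuHermTwoEtaDefs                -- ★ (K2E5-p16) `hermTwo_add`, `hermTwo_smul`
import Summits.HodgeConjecture.HodgeConjecture.Theorems.K2LiuArchIntertwiningScalarSection  -- ★ (K2Liu-p11) `det_sub_I_smul_mem_slitPlane`
import Mathlib.Analysis.SpecialFunctions.Pow.Deriv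
import Mathlib.Analysis.Calculus.LineDeriv.Basic
import Mathlib.Analysis.Complex.RealDeriv
import HarnessLib

/-!
# Crux `HLiu418`, ROAD Φ ∕ KIND W organ «Φ6b-ind», FILE 2a: LINE DERIVATIVES of the ξ-integrand on `Herm₂(ℂ)` (the Cayley calculus, first half)

Cell `hodgecm-mathlib`, crux item hLiu418 = `stmt-HodgeConjecture-24832` (helper lane `--supports … --as helper`, count-neutral), route of record
`HCCMUnconditional`; squad K2 ∕ K2Liu, road `K2_Liu`, socket #41, KIND W.  Sequel of ★ FILE 1 `K2LiuHermTwoXiEtaIdentityIndefinite` (the ξ–η identity at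
every signature).  THE GOAL OF FILES 2–4: Shimura's `ξ(g, h; α, β)` (★ `xiTwo`), absolutely convergent on the HALF-SPACE `{re(α+β) > 3}` (★
`integrable_xiTwoIntegrand`), is ENTIRE in `(α, β)` for every NON-DEGENERATE Hermitian index `h` — definite or INDEFINITE alike — by an elementary
three-term recursion raising `α + β`, obtained from two integrations by parts against the oscillation `e(−τ(hx))` [Shimura1982, §3 (3.4)–(3.7)-type
recursion formulas; the continuation statement is Thm. 3.1 ∕ Thm. 4.2 without the growth].  THIS FILE (2a) is the first-order pointwise calculus (§1–§3); FILE 2b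
`K2LiuHermTwoXiIntegrandCayley` the second derivatives and the Cayley identities (§4); FILE 3 integrates by parts, FILE 4 runs the induction.

THE CALCULUS (chart `x = hermTwo (a, z, b)`, `z = u + iv`, Lebesgue coordinates `(a, u, v, b)`; `g` ANY complex `2 × 2` matrix for the algebra, `g > 0` where
branches are differentiated).  Write `Y = g − ix`, `W = g + ix`, `P = det Y`, `Q = det W`, and `Φ_{α,β} := xiTwoIntegrand g 0 α β`
`= e^{−iπα} P^{−α} · e^{iπβ} Q^{−β}` (the ξ-integrand WITHOUT its character; `xiTwoIntegrand g h α β = e(−τ(hx)) · Φ_{α,β}`, §2).  Along a chart direction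
`v` (matrix `V = hermTwo v`): `Y(x + tV) = Y − t·iV`, so `det` is quadratic in `t` with linear coefficient the polarisation `tr(adj(Y)·V)` (§1
`det_sub_smul_fin_two`), `adj` is linear (`2 × 2`), and `P, Q` stay in the slit plane (★ `det_sub_I_smul_mem_slitPlane` (K2Liu-p11) and its conjugate §1 `det_add_I_smul_hermTwo_mem_slitPlane`), whence (§3)
  `D_v Φ_{α,β} = −iα·tr(adj(Y)V)·Φ_{α+1,β} + iβ·tr(adj(W)V)·Φ_{α,β+1}`      (`Φ_{α+1,β} = −P⁻¹Φ_{α,β}`, `Φ_{α,β+1} = −Q⁻¹Φ_{α,β}`, §2),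
  `D_{v′} tr(adj(Y)V) = −i·tr(adj(V′)V)`, `D_{v′} tr(adj(W)V) = i·tr(adj(V′)V)`,  `D_v e(−τ(hx)) = −2πi·τ(hV)·e(−τ(hx))`.
With the four directions `e_a = (1,0,0)`, `e_u = (0,1,0)`, `e_v = (0,i,0)`, `e_b = (0,0,1)` and `L := D_{e_b}D_{e_a} − ¼(D_{e_u}D_{e_u} + D_{e_v}D_{e_v})` (the Cayley
operator `det(∂_x)`: `L P^s = −s(s+1)P^{s−1}`, carré du champ `Γ(P,Q) = 2 det g − (P+Q)∕2`), §4 proves the CAYLEY IDENTITIES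
  **`L Φ_{α,β} = (α+β−1)·(α Φ_{α+1,β} + β Φ_{α,β+1}) + 4αβ·det(g)·Φ_{α+1,β+1}`**   and   **`L e(−τ(hx)) = −4π²·det(h)·e(−τ(hx))`** (any `h`),
stated on the explicit second line-derivative expressions that FILE 3 feeds to Mathlib's `integral_bilinear_hasLineDerivAt_right_eq_neg_left_of_integrable`.
Sanity check of the constants (done by hand, reproduced in FILE 3's docstring): at `h = 0` against ★ `xiTwo_zero_right` the recursion's right-hand side vanishes
identically (`det(2g) = 4 det g`).
[Shimura1982, §1 (1.25), §3] [Shimura1997, §16.4–16.5] [FarautKoranyi1994, Ch. VII §1 (Cayley-type identity `det(∂) det(x)^s = b(s) det(x)^{s−1}`)].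
HONEST LABEL.  Count-neutral helper of the K2_Liu road; it pays no socket by itself: `HC_CM` is proved only modulo the 7 printed citations
(2 remaining named inputs: hLiu418 = `stmt-HodgeConjecture-24832`, h413 = `stmt-HodgeConjecture-24833`) until rung 0 closes.

## References
* [Shimura1982] G. Shimura, *Confluent hypergeometric functions on tube domains*, Math. Ann. 260 (1982) 269–302: §1 (1.25), §3.
* [Shimura1997] G. Shimura, *Euler Products and Eisenstein Series*, CBMS 93 (1997): §16.4–16.5.
* [FarautKoranyi1994] J. Faraut, A. Korányi, *Analysis on Symmetric Cones* (1994): Ch. VII §1.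
-/

set_option autoImplicit false
-- the mandated namespace repeats the single-problem summit's segment (`HodgeConjecture.HodgeConjecture`)
set_option linter.dupNamespace false

noncomputable section

open Complex MeasureTheory Set
open scoped ComplexOrder ComplexConjugate

namespace Summit.HodgeConjecture.HodgeConjecture.Cruxes.HLiu418.K2LiuHermTwoXiIntegrandLineDeriv

open Summit.HodgeConjecture.HodgeConjecture.Cruxes.HLiu418.K2LiuHermTwoGammaDefs
open Summit.HodgeConjecture.HodgeConjecture.Cruxes.HLiu418.K2LiuHermTwoDetPowerFibres
open Summit.HodgeConjecture.HodgeConjecture.Cruxes.HLiu418.K2LiuHermTwoDetPowerIntegrable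
open Summit.HodgeConjecture.HodgeConjecture.Cruxes.HLiu418.K2LiuHermTwoConfluentXiDefs
open Summit.HodgeConjecture.HodgeConjecture.Cruxes.HLiu418.K2LiuHermTwoEtaDefs
open Summit.HodgeConjecture.HodgeConjecture.Cruxes.HLiu418.K2LiuArchIntertwiningScalarSection (det_sub_I_smul_mem_slitPlane)

/-! ## §1 Algebra of the chart: the line structure of `det`, `adj`, and the slit plane -/

/-- The chart along a line: `hermTwo (c + t·v) = hermTwo c + t·hermTwo v`. -/
theorem hermTwo_add_smul (c v : ℝ × ℂ × ℝ) (t : ℝ) : hermTwo (c + t • v) = hermTwo c + (t : ℂ) • hermTwo v := by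
  rw [hermTwo_add, hermTwo_smul]

/-- `g − i·hermTwo (c + t v) = (g − i·hermTwo c) − t·(i·hermTwo v)`. -/
theorem sub_I_smul_hermTwo_add_smul (g : Matrix (Fin 2) (Fin 2) ℂ) (c v : ℝ × ℂ × ℝ) (t : ℝ) :
    g - I • hermTwo (c + t • v) = (g - I • hermTwo c) - (t : ℂ) • (I • hermTwo v) := by
  rw [hermTwo_add_smul, smul_add, smul_comm I (t : ℂ) (hermTwo v)]
  abel

/-- `g + i·hermTwo (c + t v) = (g + i·hermTwo c) + t·(i·hermTwo v)`. -/
theorem add_I_smul_hermTwo_add_smul (g : Matrix (Fin 2) (Fin 2) ℂ) (c v : ℝ × ℂ × ℝ) (t : ℝ) :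
    g + I • hermTwo (c + t • v) = (g + I • hermTwo c) + (t : ℂ) • (I • hermTwo v) := by
  rw [hermTwo_add_smul, smul_add, smul_comm I (t : ℂ) (hermTwo v)]
  abel

/-- `det(A − wB) = det A − w·tr(adj(A)·B) + w²·det B` for `2 × 2` matrices. [folklore] -/
theorem det_sub_smul_fin_two (A B : Matrix (Fin 2) (Fin 2) ℂ) (w : ℂ) :
    (A - w • B).det = A.det - w * (A.adjugate * B).trace + w ^ 2 * B.det := by
  simp only [Matrix.det_fin_two, Matrix.adjugate_fin_two, Matrix.trace_fin_two, Matrix.mul_apply, Fin.sum_univ_two, Matrix.sub_apply,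
    Matrix.smul_apply, smul_eq_mul, Matrix.of_apply, Matrix.cons_val', Matrix.cons_val_zero, Matrix.cons_val_one, Matrix.empty_val',
    Matrix.cons_val_fin_one]
  ring

/-- `det(A + wB) = det A + w·tr(adj(A)·B) + w²·det B` for `2 × 2` matrices. [folklore] -/
theorem det_add_smul_fin_two (A B : Matrix (Fin 2) (Fin 2) ℂ) (w : ℂ) :
    (A + w • B).det = A.det + w * (A.adjugate * B).trace + w ^ 2 * B.det := by
  simp only [Matrix.det_fin_two, Matrix.adjugate_fin_two, Matrix.trace_fin_two, Matrix.mul_apply, Fin.sum_univ_two, Matrix.add_apply,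
    Matrix.smul_apply, smul_eq_mul, Matrix.of_apply, Matrix.cons_val', Matrix.cons_val_zero, Matrix.cons_val_one, Matrix.empty_val',
    Matrix.cons_val_fin_one]
  ring

/-- `adj` is LINEAR in dimension two: `adj(A − wB) = adj A − w·adj B`. [folklore] -/
theorem adjugate_sub_smul_fin_two (A B : Matrix (Fin 2) (Fin 2) ℂ) (w : ℂ) : (A - w • B).adjugate = A.adjugate - w • B.adjugate := by
  rw [Matrix.adjugate_fin_two, Matrix.adjugate_fin_two, Matrix.adjugate_fin_two]
  ext i j
  fin_cases i <;> fin_cases j <;> simp <;> ring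

/-- `adj(A + wB) = adj A + w·adj B`. [folklore] -/
theorem adjugate_add_smul_fin_two (A B : Matrix (Fin 2) (Fin 2) ℂ) (w : ℂ) : (A + w • B).adjugate = A.adjugate + w • B.adjugate := by
  rw [Matrix.adjugate_fin_two, Matrix.adjugate_fin_two, Matrix.adjugate_fin_two]
  ext i j
  fin_cases i <;> fin_cases j <;> simp <;> ring

/-- **`det(g + ix)` LIES IN THE SLIT PLANE** for `g > 0` and every Hermitian `x`: it is the complex conjugate of `det(g − ix)` (★ `det_sub_I_smul_eq_conj`),
which ★ `K2LiuArchIntertwiningScalarSection.det_sub_I_smul_mem_slitPlane` places off `(−∞, 0]`. [folklore] -/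
theorem det_add_I_smul_hermTwo_mem_slitPlane {g : Matrix (Fin 2) (Fin 2) ℂ} (hg : g.PosDef) (c : ℝ × ℂ × ℝ) :
    (g + I • hermTwo c).det ∈ slitPlane := by
  have h := det_sub_I_smul_mem_slitPlane hg c
  rw [det_sub_I_smul_eq_conj hg c, Complex.mem_slitPlane_iff, Complex.conj_re, Complex.conj_im, neg_ne_zero] at h
  exact Complex.mem_slitPlane_iff.mpr h

/-- `det(g + ix) ≠ 0` for `g > 0`. -/
theorem det_add_I_smul_hermTwo_ne_zero {g : Matrix (Fin 2) (Fin 2) ℂ} (hg : g.PosDef) (c : ℝ × ℂ × ℝ) : (g + I • hermTwo c).det ≠ 0 :=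
  norm_pos_iff.mp (norm_det_add_I_smul_pos hg c)

/-- `det(g − ix) ≠ 0` for `g > 0`. -/
theorem det_sub_I_smul_hermTwo_ne_zero {g : Matrix (Fin 2) (Fin 2) ℂ} (hg : g.PosDef) (c : ℝ × ℂ × ℝ) : (g - I • hermTwo c).det ≠ 0 := by
  rw [det_sub_I_smul_eq_conj hg c]
  exact (map_ne_zero _).mpr (det_add_I_smul_hermTwo_ne_zero hg c)

/-! ## §2 `Φ_{α,β} = xiTwoIntegrand g 0 α β`: the character-free integrand and its index shifts -/

/-- `Φ_{α,β}(x) = e^{−iπα} det(g − ix)^{−α} · e^{iπβ} det(g + ix)^{−β}` — the ξ-integrand at `h = 0` carries no character. -/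
theorem xiTwoIntegrand_zero_eq (g : Matrix (Fin 2) (Fin 2) ℂ) (α β : ℂ) (c : ℝ × ℂ × ℝ) :
    xiTwoIntegrand g 0 α β c =
      (cexp (-(Real.pi * I) * α) * (g - I • hermTwo c).det ^ (-α)) * (cexp ((Real.pi * I) * β) * (g + I • hermTwo c).det ^ (-β)) := by
  rw [xiTwoIntegrand_apply, Matrix.zero_mul, Matrix.trace_zero, mul_zero, Complex.exp_zero, one_mul]

/-- `xiTwoIntegrand g h α β = e(−τ(hx)) · Φ_{α,β}`. -/
theorem xiTwoIntegrand_eq_cexp_mul_zero (g h : Matrix (Fin 2) (Fin 2) ℂ) (α β : ℂ) (c : ℝ × ℂ × ℝ) :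
    xiTwoIntegrand g h α β c = cexp (-(2 * Real.pi * I) * (h * hermTwo c).trace) * xiTwoIntegrand g 0 α β c := by
  rw [xiTwoIntegrand_apply, xiTwoIntegrand_zero_eq]

/-- `e^{−iπ} = −1` in the form used by the branch constants. -/
theorem cexp_neg_pi_mul_I : cexp (-(Real.pi * I)) = -1 := by
  rw [Complex.exp_neg, Complex.exp_pi_mul_I]
  norm_num

/-- INDEX SHIFT IN `α`: `Φ_{α+1,β} = −det(g − ix)⁻¹ · Φ_{α,β}` (`g > 0`). -/
theorem xiTwoIntegrand_zero_succ_left {g : Matrix (Fin 2) (Fin 2) ℂ} (hg : g.PosDef) (α β : ℂ) (c : ℝ × ℂ × ℝ) :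
    xiTwoIntegrand g 0 (α + 1) β c = -(((g - I • hermTwo c).det)⁻¹ * xiTwoIntegrand g 0 α β c) := by
  have hP := det_sub_I_smul_hermTwo_ne_zero hg c
  rw [xiTwoIntegrand_zero_eq, xiTwoIntegrand_zero_eq, show -(α + 1) = -α + (-1) by ring, Complex.cpow_add _ _ hP, Complex.cpow_neg_one,
    show -(Real.pi * I) * (α + 1) = -(Real.pi * I) * α + -(Real.pi * I) by ring, Complex.exp_add, cexp_neg_pi_mul_I]
  ring

/-- INDEX SHIFT IN `β`: `Φ_{α,β+1} = −det(g + ix)⁻¹ · Φ_{α,β}` (`g > 0`). -/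
theorem xiTwoIntegrand_zero_succ_right {g : Matrix (Fin 2) (Fin 2) ℂ} (hg : g.PosDef) (α β : ℂ) (c : ℝ × ℂ × ℝ) :
    xiTwoIntegrand g 0 α (β + 1) c = -(((g + I • hermTwo c).det)⁻¹ * xiTwoIntegrand g 0 α β c) := by
  have hQ := det_add_I_smul_hermTwo_ne_zero hg c
  rw [xiTwoIntegrand_zero_eq, xiTwoIntegrand_zero_eq, show -(β + 1) = -β + (-1) by ring, Complex.cpow_add _ _ hQ, Complex.cpow_neg_one,
    show (Real.pi * I) * (β + 1) = (Real.pi * I) * β + -(-(Real.pi * I)) by ring, Complex.exp_add, Complex.exp_neg, cexp_neg_pi_mul_I]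
  ring

/-! ## §3 Line derivatives in the chart -/

/-- **LINE DERIVATIVE OF THE CHARACTER**: `D_v e(−τ(hx)) = −2πi·τ(h·hermTwo v)·e(−τ(hx))` (any `h`, any direction `v`). [folklore] -/
theorem hasLineDerivAt_cexp_trace (h : Matrix (Fin 2) (Fin 2) ℂ) (c v : ℝ × ℂ × ℝ) :
    HasLineDerivAt ℝ (fun c : ℝ × ℂ × ℝ => cexp (-(2 * Real.pi * I) * (h * hermTwo c).trace))
      (-(2 * Real.pi * I) * (h * hermTwo v).trace * cexp (-(2 * Real.pi * I) * (h * hermTwo c).trace)) c v := by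
  show HasDerivAt (fun t : ℝ => cexp (-(2 * Real.pi * I) * (h * hermTwo (c + t • v)).trace)) _ 0
  have hlin : ∀ t : ℝ, -(2 * Real.pi * I) * (h * hermTwo (c + t • v)).trace =
      -(2 * Real.pi * I) * (h * hermTwo c).trace + (t : ℂ) * (-(2 * Real.pi * I) * (h * hermTwo v).trace) := by
    intro t
    rw [hermTwo_add_smul, Matrix.mul_add, Matrix.trace_add, Matrix.mul_smul, Matrix.trace_smul, smul_eq_mul]
    ring
  simp_rw [hlin]
  have h1 : HasDerivAt (fun t : ℝ => -(2 * Real.pi * I) * (h * hermTwo c).trace + (t : ℂ) * (-(2 * Real.pi * I) * (h * hermTwo v).trace))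
      (1 * (-(2 * Real.pi * I) * (h * hermTwo v).trace)) 0 :=
    ((show HasDerivAt (fun s : ℝ => (s : ℂ)) 1 0 by simpa using (hasDerivAt_id (0 : ℝ)).ofReal_comp).mul_const _).const_add _
  have h2 := h1.cexp
  simp only [Complex.ofReal_zero, zero_mul, add_zero, one_mul] at h2
  convert h2 using 1
  ring

/-- **LINE DERIVATIVE OF THE POLARISATION COEFFICIENTS**: `D_{v′} tr(adj(g − ix)·M) = −i·tr(adj(hermTwo v′)·M)` (any `g, M`). [folklore] -/
theorem hasLineDerivAt_trace_adjugate_sub_mul (g M : Matrix (Fin 2) (Fin 2) ℂ) (c v : ℝ × ℂ × ℝ) :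
    HasLineDerivAt ℝ (fun c : ℝ × ℂ × ℝ => ((g - I • hermTwo c).adjugate * M).trace) (-(I * ((hermTwo v).adjugate * M).trace)) c v := by
  show HasDerivAt (fun t : ℝ => ((g - I • hermTwo (c + t • v)).adjugate * M).trace) _ 0
  have hlin : ∀ t : ℝ, ((g - I • hermTwo (c + t • v)).adjugate * M).trace =
      ((g - I • hermTwo c).adjugate * M).trace + (t : ℂ) * (-(I * ((hermTwo v).adjugate * M).trace)) := by
    intro t
    rw [sub_I_smul_hermTwo_add_smul, adjugate_sub_smul_fin_two, Matrix.sub_mul, Matrix.trace_sub, Matrix.smul_mul, Matrix.trace_smul,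
      smul_eq_mul, show (I • hermTwo v).adjugate = I • (hermTwo v).adjugate by rw [Matrix.adjugate_smul, Fintype.card_fin]; ring_nf,
      Matrix.smul_mul, Matrix.trace_smul, smul_eq_mul]
    ring
  simp_rw [hlin]
  have h0 : HasDerivAt (fun s : ℝ => (s : ℂ)) 1 0 := by simpa using (hasDerivAt_id (0 : ℝ)).ofReal_comp
  have h1 := (h0.mul_const (-(I * ((hermTwo v).adjugate * M).trace))).const_add (((g - I • hermTwo c).adjugate * M).trace)
  simpa using h1

/-- `D_{v′} tr(adj(g + ix)·M) = i·tr(adj(hermTwo v′)·M)`. [folklore] -/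
theorem hasLineDerivAt_trace_adjugate_add_mul (g M : Matrix (Fin 2) (Fin 2) ℂ) (c v : ℝ × ℂ × ℝ) :
    HasLineDerivAt ℝ (fun c : ℝ × ℂ × ℝ => ((g + I • hermTwo c).adjugate * M).trace) (I * ((hermTwo v).adjugate * M).trace) c v := by
  show HasDerivAt (fun t : ℝ => ((g + I • hermTwo (c + t • v)).adjugate * M).trace) _ 0
  have hlin : ∀ t : ℝ, ((g + I • hermTwo (c + t • v)).adjugate * M).trace =
      ((g + I • hermTwo c).adjugate * M).trace + (t : ℂ) * (I * ((hermTwo v).adjugate * M).trace) := by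
    intro t
    rw [add_I_smul_hermTwo_add_smul, adjugate_add_smul_fin_two, Matrix.add_mul, Matrix.trace_add, Matrix.smul_mul, Matrix.trace_smul,
      smul_eq_mul, show (I • hermTwo v).adjugate = I • (hermTwo v).adjugate by rw [Matrix.adjugate_smul, Fintype.card_fin]; ring_nf,
      Matrix.smul_mul, Matrix.trace_smul, smul_eq_mul]
  simp_rw [hlin]
  have h0 : HasDerivAt (fun s : ℝ => (s : ℂ)) 1 0 := by simpa using (hasDerivAt_id (0 : ℝ)).ofReal_comp
  have h1 := (h0.mul_const (I * ((hermTwo v).adjugate * M).trace)).const_add (((g + I • hermTwo c).adjugate * M).trace)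
  simpa using h1

/-- **LINE DERIVATIVE OF `Φ_{α,β}` IN EVERY DIRECTION** (`g > 0`):
`D_v Φ_{α,β} = −iα·tr(adj(g − ix)·hermTwo v)·Φ_{α+1,β} + iβ·tr(adj(g + ix)·hermTwo v)·Φ_{α,β+1}`
(chain rule through the principal powers on the slit plane, §1; index shifts §2). [cite: Shimura1982, §3] -/
theorem hasLineDerivAt_xiTwoIntegrand_zero {g : Matrix (Fin 2) (Fin 2) ℂ} (hg : g.PosDef) (α β : ℂ) (c v : ℝ × ℂ × ℝ) :
    HasLineDerivAt ℝ (xiTwoIntegrand g 0 α β)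
      (-(I * α * ((g - I • hermTwo c).adjugate * hermTwo v).trace) * xiTwoIntegrand g 0 (α + 1) β c +
        I * β * ((g + I • hermTwo c).adjugate * hermTwo v).trace * xiTwoIntegrand g 0 α (β + 1) c) c v := by
  show HasDerivAt (fun t : ℝ => xiTwoIntegrand g 0 α β (c + t • v)) _ 0
  set P : ℂ := (g - I • hermTwo c).det with hPdef
  set Q : ℂ := (g + I • hermTwo c).det with hQdef
  set mP : ℂ := I * ((g - I • hermTwo c).adjugate * hermTwo v).trace with hmPdef
  set mQ : ℂ := I * ((g + I • hermTwo c).adjugate * hermTwo v).trace with hmQdef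
  set dV : ℂ := (I • hermTwo v).det with hdVdef
  have hP0 : P ≠ 0 := det_sub_I_smul_hermTwo_ne_zero hg c
  have hQ0 : Q ≠ 0 := det_add_I_smul_hermTwo_ne_zero hg c
  have hPs : P ∈ slitPlane := det_sub_I_smul_mem_slitPlane hg c
  have hQs : Q ∈ slitPlane := det_add_I_smul_hermTwo_mem_slitPlane hg c
  -- the two determinants along the line, as polynomials in the complexified parameter
  have hPt : ∀ t : ℝ, (g - I • hermTwo (c + t • v)).det = P - (t : ℂ) * mP + (t : ℂ) ^ 2 * dV := by
    intro t
    rw [sub_I_smul_hermTwo_add_smul, det_sub_smul_fin_two, Matrix.mul_smul, Matrix.trace_smul, smul_eq_mul]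
  have hQt : ∀ t : ℝ, (g + I • hermTwo (c + t • v)).det = Q + (t : ℂ) * mQ + (t : ℂ) ^ 2 * dV := by
    intro t
    rw [add_I_smul_hermTwo_add_smul, det_add_smul_fin_two, Matrix.mul_smul, Matrix.trace_smul, smul_eq_mul]
  -- the complex-variable model `G w` of `t ↦ Φ_{α,β}(c + t v)`
  have hfun : (fun t : ℝ => xiTwoIntegrand g 0 α β (c + t • v)) = fun t : ℝ =>
      (fun w : ℂ => (cexp (-(Real.pi * I) * α) * (P - w * mP + w ^ 2 * dV) ^ (-α)) *
        (cexp ((Real.pi * I) * β) * (Q + w * mQ + w ^ 2 * dV) ^ (-β))) (t : ℂ) := by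
    funext t
    rw [xiTwoIntegrand_zero_eq, hPt t, hQt t]
  rw [hfun]
  refine HasDerivAt.comp_ofReal (e := fun w : ℂ => (cexp (-(Real.pi * I) * α) * (P - w * mP + w ^ 2 * dV) ^ (-α)) *
    (cexp ((Real.pi * I) * β) * (Q + w * mQ + w ^ 2 * dV) ^ (-β))) ?_
  rw [Complex.ofReal_zero]
  -- derivatives of the two quadratics at `w = 0`
  have hPw : HasDerivAt (fun w : ℂ => P - w * mP + w ^ 2 * dV) (-mP) 0 := by
    have h := (((hasDerivAt_id (0 : ℂ)).mul_const mP).const_sub P).add (((hasDerivAt_id (0 : ℂ)).pow 2).mul_const dV)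
    refine h.congr_deriv ?_
    simp
  have hQw : HasDerivAt (fun w : ℂ => Q + w * mQ + w ^ 2 * dV) mQ 0 := by
    have h := (((hasDerivAt_id (0 : ℂ)).mul_const mQ).const_add Q).add (((hasDerivAt_id (0 : ℂ)).pow 2).mul_const dV)
    refine h.congr_deriv ?_
    simp
  have hP0' : (fun w : ℂ => P - w * mP + w ^ 2 * dV) 0 ∈ slitPlane := by
    show P - 0 * mP + (0 : ℂ) ^ 2 * dV ∈ slitPlane
    rw [zero_mul, sub_zero, zero_pow two_ne_zero, zero_mul, add_zero]
    exact hPs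
  have hQ0' : (fun w : ℂ => Q + w * mQ + w ^ 2 * dV) 0 ∈ slitPlane := by
    show Q + 0 * mQ + (0 : ℂ) ^ 2 * dV ∈ slitPlane
    rw [zero_mul, add_zero, zero_pow two_ne_zero, zero_mul, add_zero]
    exact hQs
  have hPc := (hPw.cpow_const (c := -α) hP0').const_mul (cexp (-(Real.pi * I) * α))
  have hQc := (hQw.cpow_const (c := -β) hQ0').const_mul (cexp ((Real.pi * I) * β))
  have hprod := hPc.mul hQc
  simp only [zero_mul, sub_zero, add_zero, ne_eq, OfNat.ofNat_ne_zero, not_false_eq_true, zero_pow] at hprod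
  refine hprod.congr_deriv ?_
  -- identify the derivative with the `Φ`-form
  rw [xiTwoIntegrand_zero_succ_left hg, xiTwoIntegrand_zero_succ_right hg, xiTwoIntegrand_zero_eq, ← hPdef, ← hQdef,
    show -α - 1 = -α + (-1) by ring, show -β - 1 = -β + (-1) by ring, Complex.cpow_add _ _ hP0, Complex.cpow_add _ _ hQ0,
    Complex.cpow_neg_one, Complex.cpow_neg_one]
  rw [hmPdef, hmQdef]
  field_simp

/-- The line derivative of `Φ_{α,β}` as a function (`lineDeriv`). -/
theorem lineDeriv_xiTwoIntegrand_zero {g : Matrix (Fin 2) (Fin 2) ℂ} (hg : g.PosDef) (α β : ℂ) (c v : ℝ × ℂ × ℝ) :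
    lineDeriv ℝ (xiTwoIntegrand g 0 α β) c v =
      -(I * α * ((g - I • hermTwo c).adjugate * hermTwo v).trace) * xiTwoIntegrand g 0 (α + 1) β c +
        I * β * ((g + I • hermTwo c).adjugate * hermTwo v).trace * xiTwoIntegrand g 0 α (β + 1) c :=
  (hasLineDerivAt_xiTwoIntegrand_zero hg α β c v).lineDeriv

/-- The line derivative of the character as a function (`lineDeriv`). -/
theorem lineDeriv_cexp_trace (h : Matrix (Fin 2) (Fin 2) ℂ) (c v : ℝ × ℂ × ℝ) :
    lineDeriv ℝ (fun c : ℝ × ℂ × ℝ => cexp (-(2 * Real.pi * I) * (h * hermTwo c).trace)) c v =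
      -(2 * Real.pi * I) * (h * hermTwo v).trace * cexp (-(2 * Real.pi * I) * (h * hermTwo c).trace) :=
  (hasLineDerivAt_cexp_trace h c v).lineDeriv

end Summit.HodgeConjecture.HodgeConjecture.Cruxes.HLiu418.K2LiuHermTwoXiIntegrandLineDeriv

end
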